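import Mathlib
import HarnessLib

/-!
# Poisson summation on the `N`-grid of the unit torus (the aliasing formula of trigonometric interpolation)

Topic `Literature/Analysis/Fourier`; namespace `Literature.Analysis.Fourier`.  For a continuous function `f` on the torus
`(ℝ/ℤ)^d` (Mathlib's `UnitAddTorus d`) with absolutely summable Fourier coefficients `f̂ = mFourierCoeff f`, the average of `f` over the
grid `{j/N : j ∈ (ℤ/N)^d}` is the sum of the Fourier coefficients at the frequencies divisible by `N`:

  `Σ_{j ∈ (ℤ/N)^d} f(j/N) = N^d · Σ_{k ∈ ℤ^d, N ∣ k} f̂(k)`      (`sum_torusGrid_eq_tsum_mFourierCoeff`),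

i.e. the grid average differs from the torus average `f̂(0)` by the ALIASED coefficients `Σ_{k ≠ 0, N ∣ k} f̂(k)`
(`norm_torusGridAvg_sub_mFourierCoeff_zero_le`).  Ingredients: pointwise convergence of the Fourier series
(`UnitAddTorus.hasSum_mFourier_series_apply_of_summable`), the finite sum over the grid commutes with the series, and the character sum
`Σ_{t ∈ ℤ/N} e^{2πi n t/N} = N·[N ∣ n]` (`AddChar.sum_mulShift` for Mathlib's primitive character `ZMod.stdAddChar`), taken coordinatewise
(`sum_fourier_zmodGrid`, `sum_mFourier_torusGrid`).  This is the Poisson summation formula for the finite subgroup `(N⁻¹ℤ/ℤ)^d` of the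
compact group `(ℝ/ℤ)^d`; in one variable it is the `n = 0` case of the ALIASING IDENTITY of trigonometric interpolation,
`a_n = α_n + Σ_{j ≥ 1} (α_{n+jN} + α_{−n+jN})` [cite: Boyd2001, §4.5 Theorem 19 (4.43)–(4.44)] (J. P. Boyd, *Chebyshev and Fourier Spectral
Methods*, 2nd ed., Dover 2001, p. 142; proof there by reference to Young–Gregory 1972), and the error form is the `n = 0` case of
[cite: Boyd2001, §4.5 Theorem 20 (4.47)]; the `d`-variable statement is the same computation coordinatewise (product characters).

Used by the Hubbard `KLProgramme` (lane c4a-1, LAYER 2 of the tadpole representation: a lattice loop sum over the Brillouin-zone grid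
`(2π/L)ℤ_L²` equals the continuum loop integral plus aliasing terms controlled by the real-space tail of the slice function).
-/

noncomputable section

open Complex Finset UnitAddTorus

namespace Literature.Analysis.Fourier

variable {d : Type*}

/-- The point `j/N` of the `N`-grid of the unit torus `(ℝ/ℤ)^d`, `j ∈ (ℤ/N)^d` (coordinate `i` is `(j i).val / N mod 1`). [folklore] -/
def torusGridPoint (N : ℕ) (j : d → ZMod N) : UnitAddTorus d := fun i => ((((j i).val : ℝ) / N : ℝ) : UnitAddCircle)

variable [Fintype d] [DecidableEq d]

omit [Fintype d] [DecidableEq d] in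
/-- **The character sum over `ℤ/N`** (exactness of the trapezoidal rule on trigonometric monomials): `Σ_{t ∈ ℤ/N} e^{2πi n t/N} = N` if `N ∣ n`,
and `0` otherwise. [cite: Boyd2001, §4.5 Theorem 19 (4.43)] -/
theorem sum_fourier_zmodGrid (N : ℕ) [NeZero N] (n : ℤ) :
    ∑ t : ZMod N, fourier n ((((t.val : ℝ) / N : ℝ)) : UnitAddCircle) = if (N : ℤ) ∣ n then (N : ℂ) else 0 := by
  classical
  have key : ∀ t : ZMod N, fourier n ((((t.val : ℝ) / N : ℝ)) : UnitAddCircle) = ZMod.stdAddChar (t * (n : ZMod N)) := by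
    intro t
    have ht : (t * (n : ZMod N)) = (((t.val : ℤ) * n : ℤ) : ZMod N) := by
      push_cast
      rw [ZMod.natCast_zmod_val]
    rw [fourier_coe_apply, ht, ZMod.stdAddChar_coe]
    congr 1
    have hN : (N : ℂ) ≠ 0 := Nat.cast_ne_zero.2 (NeZero.ne N)
    push_cast
    field_simp
  simp_rw [key]
  rw [AddChar.sum_mulShift _ (ZMod.isPrimitive_stdAddChar N), ZMod.card]
  by_cases h : (N : ℤ) ∣ n
  · rw [if_pos ((ZMod.intCast_zmod_eq_zero_iff_dvd n N).2 h), if_pos h]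
  · rw [if_neg (fun h' => h ((ZMod.intCast_zmod_eq_zero_iff_dvd n N).1 h')), if_neg h, Nat.cast_zero]

/-- **The character sum over the grid `(ℤ/N)^d`** (coordinatewise product of the one-variable sums): `Σ_j e_k(j/N) = N^d` if `N ∣ k_i` for all `i`,
and `0` otherwise. [cite: Boyd2001, §4.5 Theorem 19 (4.43)] -/
theorem sum_mFourier_torusGrid (N : ℕ) [NeZero N] (k : d → ℤ) :
    ∑ j : d → ZMod N, mFourier k (torusGridPoint N j) = if ∀ i, (N : ℤ) ∣ k i then (N : ℂ) ^ Fintype.card d else 0 := by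
  classical
  have h1 : ∀ j : d → ZMod N, mFourier k (torusGridPoint N j) =
      ∏ i, fourier (k i) (((((j i).val : ℝ) / N : ℝ)) : UnitAddCircle) := fun j => rfl
  simp_rw [h1]
  rw [← Fintype.piFinset_univ, ← Finset.prod_univ_sum (fun _ => (univ : Finset (ZMod N)))
    (fun i t => fourier (k i) ((((t.val : ℝ) / N : ℝ)) : UnitAddCircle))]
  simp_rw [sum_fourier_zmodGrid]
  by_cases h : ∀ i, (N : ℤ) ∣ k i
  · rw [if_pos h, Finset.prod_congr rfl (fun i _ => if_pos (h i)), Finset.prod_const, Finset.card_univ]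
  · rw [if_neg h]
    obtain ⟨i, hi⟩ := not_forall.1 h
    exact Finset.prod_eq_zero (Finset.mem_univ i) (if_neg hi)

/-- **Poisson summation on the `N`-grid of the unit torus (aliasing formula).**  For `f ∈ C((ℝ/ℤ)^d)` with absolutely summable Fourier
coefficients, `Σ_{j ∈ (ℤ/N)^d} f(j/N) = N^d · Σ_{k : N ∣ k} f̂(k)` — the `n = 0`, `d`-variable case of the aliasing identity
`a_n = α_n + Σ_j (α_{n+jN} + α_{-n+jN})`. [cite: Boyd2001, §4.5 Theorem 19 (4.44)] -/
theorem sum_torusGrid_eq_tsum_mFourierCoeff (N : ℕ) [NeZero N] (f : C(UnitAddTorus d, ℂ)) (hf : Summable (mFourierCoeff f)) :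
    ∑ j : d → ZMod N, f (torusGridPoint N j) =
      (N : ℂ) ^ Fintype.card d * ∑' k : d → ℤ, (if ∀ i, (N : ℤ) ∣ k i then mFourierCoeff f k else 0) := by
  classical
  have hpt : ∀ j : d → ZMod N,
      HasSum (fun k : d → ℤ => mFourierCoeff f k • mFourier k (torusGridPoint N j)) (f (torusGridPoint N j)) :=
    fun j => hasSum_mFourier_series_apply_of_summable hf _
  have h1 : HasSum (fun k : d → ℤ => ∑ j : d → ZMod N, mFourierCoeff f k • mFourier k (torusGridPoint N j))
      (∑ j : d → ZMod N, f (torusGridPoint N j)) := hasSum_sum fun j _ => hpt j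
  have h2 : (fun k : d → ℤ => ∑ j : d → ZMod N, mFourierCoeff f k • mFourier k (torusGridPoint N j)) =
      fun k => (N : ℂ) ^ Fintype.card d * (if ∀ i, (N : ℤ) ∣ k i then mFourierCoeff f k else 0) := by
    funext k
    rw [← Finset.smul_sum, sum_mFourier_torusGrid, smul_eq_mul]
    split_ifs <;> ring
  rw [h2] at h1
  rw [← h1.tsum_eq, tsum_mul_left]

omit [DecidableEq d] in
/-- The aliased coefficients are absolutely summable (plumbing for the error form). [cite: Boyd2001, §4.5 Theorem 20 (4.47)] -/
theorem summable_aliased_mFourierCoeff (N : ℕ) (f : C(UnitAddTorus d, ℂ)) (hf : Summable (mFourierCoeff f)) :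
    Summable fun k : d → ℤ => (if k ≠ 0 ∧ ∀ i, (N : ℤ) ∣ k i then mFourierCoeff f k else 0) := by
  classical
  refine Summable.of_norm_bounded hf.norm (fun k => ?_)
  split_ifs
  · exact le_rfl
  · rw [norm_zero]; exact norm_nonneg _

/-- **The aliasing error of the grid average.**  `‖N^{-d} Σ_j f(j/N) − f̂(0)‖ ≤ Σ_{k ≠ 0, N ∣ k} ‖f̂(k)‖` — the grid quadrature of a
torus function is exact up to the Fourier coefficients at the nonzero frequencies divisible by `N` (the `n = 0` case of the interpolation-error
bound "sum of the absolute values of all the neglected coefficients"). [cite: Boyd2001, §4.5 Theorem 20 (4.47)] -/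
theorem norm_torusGridAvg_sub_mFourierCoeff_zero_le (N : ℕ) [NeZero N] (f : C(UnitAddTorus d, ℂ)) (hf : Summable (mFourierCoeff f)) :
    ‖((N : ℂ) ^ Fintype.card d)⁻¹ * ∑ j : d → ZMod N, f (torusGridPoint N j) - mFourierCoeff f 0‖ ≤
      ∑' k : d → ℤ, (if k ≠ 0 ∧ ∀ i, (N : ℤ) ∣ k i then ‖mFourierCoeff f k‖ else 0) := by
  classical
  have hN : ((N : ℂ) ^ Fintype.card d) ≠ 0 := pow_ne_zero _ (Nat.cast_ne_zero.2 (NeZero.ne N))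
  rw [sum_torusGrid_eq_tsum_mFourierCoeff N f hf, ← mul_assoc, inv_mul_cancel₀ hN, one_mul]
  -- split off the `k = 0` term
  have hsplit : ∀ k : d → ℤ, (if ∀ i, (N : ℤ) ∣ k i then mFourierCoeff f k else 0) =
      (if k = 0 then mFourierCoeff f 0 else 0) + (if k ≠ 0 ∧ ∀ i, (N : ℤ) ∣ k i then mFourierCoeff f k else 0) := by
    intro k
    by_cases hk : k = 0
    · subst hk; simp
    · by_cases hd : ∀ i, (N : ℤ) ∣ k i
      · simp [hk, hd]
      · simp [hk, hd]
  have hs0 : Summable fun k : d → ℤ => (if k = 0 then mFourierCoeff f 0 else 0) := summable_of_ne_finset_zero (s := {0}) (by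
    intro k hk; rw [Finset.mem_singleton] at hk; exact if_neg hk)
  have hs1 := summable_aliased_mFourierCoeff N f hf
  simp_rw [hsplit]
  rw [hs0.tsum_add hs1, tsum_ite_eq, add_sub_cancel_left]
  refine (norm_tsum_le_tsum_norm hs1.norm).trans (le_of_eq (tsum_congr fun k => ?_))
  split_ifs <;> simp

end Literature.Analysis.Fourier
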